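import Mathlib
import HarnessLib
import Summits.Ventures.LatticeQCDFlow.Exactness.NCMCGeneralSpaceMarkovErgodicCriteria

/-!
# Two independent minorised restart chains: the self-consistent Bennett (BAR) estimate from correlated equilibrium starts on BOTH legs converges to `ΔF` almost surely

HONEST FRAMING: exact (Metropolis-corrected) sampling algorithms for lattice gauge theory;
figures of merit are autocorrelation/cost numbers at stated couplings and volumes; no
continuum-physics claim.

Venture `LatticeQCDFlow` (cell pub-lqcd), topic `Exactness`; FANOUT row 13 (`eng-snf`, GEN-16).
NEW WORK of the cell, not a published result; no definition is introduced; nothing is cited as a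
fact.  Continuation of `NCMCGeneralSpaceMarkovErgodicCriteria.lean`.  The engine's `estimators.bar`
with correlated starts runs TWO level samplers — `K₀` at the prior level (forward evolutions
`κF`, start map `s`) and `K₁` at the target level (reverse evolutions `κR`, start map `e`) —
independently, and pairs the `i`-th forward record with the `i`-th reverse record.  The pair stream
is the Markov chain on `E × E` with the PARALLEL-PRODUCT kernel (Mathlib `Kernel.parallelComp`,
`∥ₖ`) of the two restart kernels, started in `P_F ⊗ P_R`.

## Content

* **`invariant_parallelComp`** — `π₁ ⊗ π₂` is invariant for `κ₁ ∥ₖ κ₂` when each factor is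
  (`Measure.prod_eq` on rectangles + `lintegral_prod_mul`).
* `measure_le_parallelComp`, `prod_apply_univ_ne_zero` — minorising measures multiply:
  `m₁ ⊗ m₂ ≤ (κ₁ ∥ₖ κ₂)(p, ·)` (`Measure.prod_mono`); **`ergodic_shift_chain_parallelComp`** — two
  independent stationary chains each minorised by a non-zero finite measure form an ERGODIC pair
  chain (criterion of `NCMCGeneralSpaceMarkovErgodic`, measure form).
* `map_fst_eval_chain_prod` / `map_snd_eval_chain_prod` — the leg marginals of the pair chain are
  `π₁`, `π₂`.
* **`CrooksPair.tendsto_barRoot_ae_restartChains_of_measure_le`** — THE ENGINE COROLLARY: for a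
  Crooks pair, a `ν₀`-invariant prior-level sampler `K₀` and a `ν₁`-invariant target-level sampler
  `K₁`, each minorised by a non-zero finite measure, every root sequence of the sample Bennett
  equation along the paired equilibrium restart chains converges to `ΔF` ALMOST SURELY.

NOT CLAIMED: minorisation constants for concrete sweeps; error bars; equal-index coupling between
the legs other than independence (the abstract `tendsto_barRoot_ae_of_ergodic` allows any, this
instance is the independent one).
-/

namespace Summit.Ventures.LatticeQCDFlow.Exactness.GeneralNCMC

open MeasureTheory ProbabilityTheory Set Filter Finset Preorder
open scoped ENNReal Topology

/-! ## Parallel products of kernels: invariance, minorisation, ergodicity -/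

section Pair

variable {S₁ S₂ : Type*} [MeasurableSpace S₁] [MeasurableSpace S₂]
variable (κ₁ : Kernel S₁ S₁) (κ₂ : Kernel S₂ S₂) [IsMarkovKernel κ₁] [IsMarkovKernel κ₂]

/-- **`π₁ ⊗ π₂` is invariant for `κ₁ ∥ₖ κ₂`** when `πᵢ` is invariant for `κᵢ`. -/
theorem invariant_parallelComp {π₁ : Measure S₁} {π₂ : Measure S₂} [IsProbabilityMeasure π₁]
    [IsProbabilityMeasure π₂] (h₁ : Kernel.Invariant κ₁ π₁) (h₂ : Kernel.Invariant κ₂ π₂) :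
    Kernel.Invariant (κ₁ ∥ₖ κ₂) (π₁.prod π₂) := by
  unfold Kernel.Invariant
  haveI : IsProbabilityMeasure ((π₁.prod π₂).bind ⇑(κ₁ ∥ₖ κ₂)) := inferInstance
  refine (Measure.prod_eq fun s t hs ht => ?_).symm
  rw [Measure.bind_apply (hs.prod ht) (Kernel.aemeasurable _)]
  simp_rw [Kernel.parallelComp_apply_prod]
  rw [lintegral_prod_mul (Kernel.measurable_coe κ₁ hs).aemeasurable
      (Kernel.measurable_coe κ₂ ht).aemeasurable,
    ← Measure.bind_apply hs (Kernel.aemeasurable _), ← Measure.bind_apply ht (Kernel.aemeasurable _),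
    h₁.def, h₂.def]

/-- Minorising measures multiply: `m₁ ⊗ m₂ ≤ (κ₁ ∥ₖ κ₂)(p, ·)`. -/
theorem measure_le_parallelComp {m₁ : Measure S₁} {m₂ : Measure S₂} [SFinite m₂]
    (h₁ : ∀ z, m₁ ≤ κ₁ z) (h₂ : ∀ z, m₂ ≤ κ₂ z) (p : S₁ × S₂) :
    m₁.prod m₂ ≤ (κ₁ ∥ₖ κ₂) p := by
  rw [Kernel.parallelComp_apply]
  exact Measure.prod_mono (h₁ p.1) (h₂ p.2)

omit [MeasurableSpace S₁] [MeasurableSpace S₂] in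
/-- The product of two non-zero finite measures is non-zero. -/
theorem prod_apply_univ_ne_zero [MeasurableSpace S₁] [MeasurableSpace S₂] {m₁ : Measure S₁}
    {m₂ : Measure S₂} [SFinite m₁] [SFinite m₂] (h₁ : m₁ univ ≠ 0) (h₂ : m₂ univ ≠ 0) :
    (m₁.prod m₂) univ ≠ 0 := by
  rw [← Set.univ_prod_univ, Measure.prod_prod]
  exact mul_ne_zero h₁ h₂

/-- **Two independent stationary chains, each minorised by a non-zero finite measure, form an
ergodic pair chain.** -/
theorem ergodic_shift_chain_parallelComp {π₁ : Measure S₁} {π₂ : Measure S₂}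
    [IsProbabilityMeasure π₁] [IsProbabilityMeasure π₂] (h₁ : Kernel.Invariant κ₁ π₁)
    (h₂ : Kernel.Invariant κ₂ π₂) {m₁ : Measure S₁} {m₂ : Measure S₂} [IsFiniteMeasure m₁]
    [IsFiniteMeasure m₂] (hm₁ : m₁ univ ≠ 0) (hm₂ : m₂ univ ≠ 0) (hmin₁ : ∀ z, m₁ ≤ κ₁ z)
    (hmin₂ : ∀ z, m₂ ≤ κ₂ z) :
    Ergodic (fun (x : ℕ → S₁ × S₂) (k : ℕ) => x (k + 1))
      (Kernel.trajMeasure (X := fun _ : ℕ => S₁ × S₂) (π₁.prod π₂)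
        (fun n : ℕ => (κ₁ ∥ₖ κ₂).comap
          (fun h : (j : ↥(Finset.Iic n)) → S₁ × S₂ => h ⟨n, Finset.mem_Iic.2 le_rfl⟩)
          (measurable_pi_apply _))) :=
  ergodic_shift_chain_of_measure_le _ (invariant_parallelComp κ₁ κ₂ h₁ h₂)
    (m := m₁.prod m₂) (prod_apply_univ_ne_zero hm₁ hm₂) (measure_le_parallelComp κ₁ κ₂ hmin₁ hmin₂)

/-- The first-leg marginal of the pair chain at time `0` is `π₁`. -/
theorem map_fst_eval_chain_prod {π₁ : Measure S₁} {π₂ : Measure S₂} [IsProbabilityMeasure π₁]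
    [IsProbabilityMeasure π₂] (h₁ : Kernel.Invariant κ₁ π₁) (h₂ : Kernel.Invariant κ₂ π₂) :
    (Kernel.trajMeasure (X := fun _ : ℕ => S₁ × S₂) (π₁.prod π₂)
        (fun n : ℕ => (κ₁ ∥ₖ κ₂).comap
          (fun h : (j : ↥(Finset.Iic n)) → S₁ × S₂ => h ⟨n, Finset.mem_Iic.2 le_rfl⟩)
          (measurable_pi_apply _))).map (fun x : ℕ → S₁ × S₂ => (x 0).1) = π₁ := by
  rw [show (fun x : ℕ → S₁ × S₂ => (x 0).1) = Prod.fst ∘ fun x : ℕ → S₁ × S₂ => x 0 from rfl,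
    ← Measure.map_map measurable_fst (measurable_pi_apply 0),
    chain_map_eval_of_invariant _ (invariant_parallelComp κ₁ κ₂ h₁ h₂) 0, Measure.map_fst_prod,
    measure_univ, one_smul]

/-- The second-leg marginal of the pair chain at time `0` is `π₂`. -/
theorem map_snd_eval_chain_prod {π₁ : Measure S₁} {π₂ : Measure S₂} [IsProbabilityMeasure π₁]
    [IsProbabilityMeasure π₂] (h₁ : Kernel.Invariant κ₁ π₁) (h₂ : Kernel.Invariant κ₂ π₂) :
    (Kernel.trajMeasure (X := fun _ : ℕ => S₁ × S₂) (π₁.prod π₂)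
        (fun n : ℕ => (κ₁ ∥ₖ κ₂).comap
          (fun h : (j : ↥(Finset.Iic n)) → S₁ × S₂ => h ⟨n, Finset.mem_Iic.2 le_rfl⟩)
          (measurable_pi_apply _))).map (fun x : ℕ → S₁ × S₂ => (x 0).2) = π₂ := by
  rw [show (fun x : ℕ → S₁ × S₂ => (x 0).2) = Prod.snd ∘ fun x : ℕ → S₁ × S₂ => x 0 from rfl,
    ← Measure.map_map measurable_snd (measurable_pi_apply 0),
    chain_map_eval_of_invariant _ (invariant_parallelComp κ₁ κ₂ h₁ h₂) 0, Measure.map_snd_prod,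
    measure_univ, one_smul]

end Pair

/-! ## The engine corollary: BAR from two independent minorised restart chains -/

namespace CrooksPair

variable {Ω E : Type*} [MeasurableSpace Ω] [MeasurableSpace E]
variable {ν₀ ν₁ : Measure Ω} {κF κR : Kernel Ω E} {s e : E → Ω} {W : E → ℝ}

/-- `P_R` is invariant for the restart kernel of the REVERSE records of a Crooks pair whose
target-level sampler `K₁` leaves `ν₁` invariant (the reverse record remembers its start `e ε`). -/
theorem invariant_restartKernel_rev (K₁ : Kernel Ω Ω) [IsMarkovKernel K₁] [IsMarkovKernel κR]
    (hK : Kernel.Invariant K₁ ν₁) (h : CrooksPair ν₀ ν₁ κF κR s e W) :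
    Kernel.Invariant ((κR ∘ₖ K₁).comap e h.measurable_e) (fwdPathLaw ν₁ κR) := by
  rw [fwdPathLaw_eq_bind_smul]
  exact GeneralNCMC.invariant_restartKernel K₁ κR h.measurable_e h.end_ae (invariant_smul K₁ hK _)

/-- **BAR FROM CORRELATED STARTS ON BOTH LEGS.**  For a Crooks pair with `e^{−ΔF} = Z₁/Z₀`, a
`ν₀`-invariant prior-level sampler `K₀` and a `ν₁`-invariant target-level sampler `K₁`, each
minorised by a non-zero finite measure (`m₀ ≤ K₀(z,·)`, `m₁ ≤ K₁(z,·)`): along the two independent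
equilibrium restart chains of forward and reverse records, paired index by index, EVERY sequence
`d_n` solving the sample Bennett equation for all large `n` converges to `ΔF` almost surely. -/
theorem tendsto_barRoot_ae_restartChains_of_measure_le (K₀ K₁ : Kernel Ω Ω) [IsMarkovKernel K₀]
    [IsMarkovKernel K₁] [IsFiniteMeasure ν₀] [IsFiniteMeasure ν₁] [IsMarkovKernel κF]
    [IsMarkovKernel κR] (h0 : ν₀ univ ≠ 0) (h1 : ν₁ univ ≠ 0) (hK₀ : Kernel.Invariant K₀ ν₀)
    (hK₁ : Kernel.Invariant K₁ ν₁) (h : CrooksPair ν₀ ν₁ κF κR s e W) {ΔF : ℝ}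
    (hΔF : Real.exp (-ΔF) = ((ν₀ univ)⁻¹ * ν₁ univ).toReal)
    {m₀ m₁ : Measure Ω} [IsFiniteMeasure m₀] [IsFiniteMeasure m₁] (hm₀ : m₀ univ ≠ 0)
    (hm₁ : m₁ univ ≠ 0) (hmin₀ : ∀ z, m₀ ≤ K₀ z) (hmin₁ : ∀ z, m₁ ≤ K₁ z) :
    haveI := isProbabilityMeasure_fwdPathLaw ν₀ h0 κF
    haveI := isProbabilityMeasure_fwdPathLaw ν₁ h1 κR
    ∀ᵐ x ∂(Kernel.trajMeasure (X := fun _ : ℕ => E × E)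
        ((fwdPathLaw ν₀ κF).prod (fwdPathLaw ν₁ κR))
        (fun n : ℕ => (((κF ∘ₖ K₀).comap s h.measurable_s) ∥ₖ ((κR ∘ₖ K₁).comap e h.measurable_e)).comap
          (fun hh : (j : ↥(Finset.Iic n)) → E × E => hh ⟨n, Finset.mem_Iic.2 le_rfl⟩)
          (measurable_pi_apply _))),
      ∀ dseq : ℕ → ℝ,
        (∀ᶠ n : ℕ in atTop, (∑ i ∈ range n, Real.sigmoid (dseq n - W (x i).1)) -
          ∑ i ∈ range n, Real.sigmoid (W (x i).2 - dseq n) = 0) →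
        Tendsto dseq atTop (𝓝 ΔF) := by
  haveI := isProbabilityMeasure_fwdPathLaw ν₀ h0 κF
  haveI := isProbabilityMeasure_fwdPathLaw ν₁ h1 κR
  have hI₀ := h.invariant_restartKernel K₀ hK₀
  have hI₁ := h.invariant_restartKernel_rev K₁ hK₁
  haveI : IsFiniteMeasure (m₀.bind κF) := inferInstance
  haveI : IsFiniteMeasure (m₁.bind κR) := inferInstance
  have hErg := ergodic_shift_chain_parallelComp _ _ hI₀ hI₁ (m₁ := m₀.bind κF) (m₂ := m₁.bind κR)
    (by rw [bind_apply_univ_of_markov]; exact hm₀) (by rw [bind_apply_univ_of_markov]; exact hm₁)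
    (measure_le_comp_comap K₀ κF h.measurable_s hmin₀)
    (measure_le_comp_comap K₁ κR h.measurable_e hmin₁)
  exact h.tendsto_barRoot_ae_of_ergodic h0 h1 hΔF hErg (map_fst_eval_chain_prod _ _ hI₀ hI₁)
    (map_snd_eval_chain_prod _ _ hI₀ hI₁)

end CrooksPair

end Summit.Ventures.LatticeQCDFlow.Exactness.GeneralNCMC
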